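import Summits.NavierStokesRegularity.FunctionalMining.HsWeightedDissipation
import HarnessLib

/-!
# FunctionalMining — the Hölder step of the Foias–Guillopé–Temam time averages of the family `EF.s`:
# `∫₀ᵀ E_{s+1}^{1/(2s+1)} ≤ (W/ν)^{1/(2s+1)} (T + ∫₀ᵀ E_s^{1/(2s−1)})^{2s/(2s+1)}` (`s ≥ 1`)

Search for candidate a priori estimates; no regularity claim. Cell `pub-nsfunc`, lit seat (gen 16);
second of three files (`HsWeightedDissipation`, this file, `HsTimeAverages`) typing Foias–Guillopé–Temam
1981 Thm 3.1 (= Chen 1994 Thm 2 (3.4)–(3.5) [held, p. 103]) at every real order for classical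
zero-mean solutions of unforced Navier–Stokes on `[0, T] × T³` (`E_s = torusHsEnergy s`). THIS FILE is
the passage from the weighted dissipation bound (3.4) at order `s` and the time average at order `s` to
the time average at order `s + 1` — Hölder with exponents `(2s+1, (2s+1)/(2s))` in time:

* `HsTimeAverages.integral_rpow_mul_rpow_le` — Hölder on `[0, T]` for functions continuous and
  non-negative on `[0, T]` with conjugate weights: `∫₀ᵀ f^a g^b ≤ (∫₀ᵀ f)^a (∫₀ᵀ g)^b`, `a + b = 1`;
* `HsTimeAverages.timeAverage_step` — if `ν∫₀ᵀ E_{s+1}/(1+E_s)^{1+1/(2s−1)} ≤ W` and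
  `∫₀ᵀ E_s^{1/(2s−1)} ≤ A` (`s ≥ 1`) then `∫₀ᵀ E_{s+1}^{1/(2s+1)} ≤ (W/ν)^{1/(2s+1)} (T + A)^{2s/(2s+1)}`
  (`E_{s+1}^{1/(2s+1)} = [E_{s+1}/(1+E_s)^{β}]^{1/(2s+1)} (1+E_s)^{β/(2s+1)}`, `β = 1 + 1/(2s−1)`,
  `β/(2s+1) · (2s+1)/(2s) = 1/(2s−1)`, and `(1+E_s)^{1/(2s−1)} ≤ 1 + E_s^{1/(2s−1)}` as `1/(2s−1) ≤ 1`).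

A priori bookkeeping in the energy class; no regularity claim.

## Mathlib / tree search

Tree (used): `HsTimeAverages.continuousOn_hsEnergy` (`HsWeightedDissipation`), `torusHsEnergy_nonneg`;
Mathlib `integral_mul_le_Lp_mul_Lq_of_nonneg`, `Real.holderConjugate_iff`, `MemLp.of_bound`,
`Real.rpow_add_le_add_rpow`, `intervalIntegral.integral_mono_on`. The template is the square `(3,1)`
of `TorusNSFoiasGuillopeTemamH3` (`Torus.classicalNS_integral_gradNormSq_laplacian_fifth_le`).

## References

* [FoiasGuillopeTemam1981] C. Foias, C. Guillopé, R. Temam, *New a priori estimates for Navier–Stokes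
  equations in dimension 3*, Comm. PDE 6 (1981) 329–359, Thm 3.1.
* [Chen1994GevreyAPriori] W. Chen, *New a priori estimates in Gevrey class of regularity for weak
  solutions of 3D Navier–Stokes equations*, Differential Integral Equations 7 (1994) 101–107, Thm 2
  (3.4)–(3.5) [held: paper:doi-10-57262-die-1369926969, p. 103].
* [Gibbon2019Chessboard] J. D. Gibbon, J. Nonlinear Sci. 29 (2019) 215–228, Thm 1, Table 1 (column
  `m = 1`).
-/

noncomputable section

open MeasureTheory Set Filter Topology Function Real intervalIntegral
open scoped InnerProductSpace RealInnerProductSpace ENNReal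

namespace Summit.NavierStokesRegularity.FunctionalMining

open Literature.Analysis Literature.Analysis.FunctionSpaces Literature.Analysis.FluidPDE
open Literature.Analysis.FunctionSpaces.Torus Literature.Analysis.FluidPDE.Torus

namespace HsTimeAverages

/-! ## 3. Hölder in time: the step `s ↦ s + 1` of the time averages (3.5) -/

/-- **Hölder on `[0, T]` with conjugate weights** for functions continuous and non-negative on
`[0, T]`: `∫₀ᵀ f^a g^b ≤ (∫₀ᵀ f)^a (∫₀ᵀ g)^b`, `0 < a`, `0 < b`, `a + b = 1`. [folklore] -/
theorem integral_rpow_mul_rpow_le {f g : ℝ → ℝ} {T a b : ℝ} (hT : 0 < T) (ha : 0 < a) (hb : 0 < b)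
    (hab : a + b = 1) (hfc : ContinuousOn f (Icc 0 T)) (hgc : ContinuousOn g (Icc 0 T))
    (hf0 : ∀ t ∈ Icc 0 T, 0 ≤ f t) (hg0 : ∀ t ∈ Icc 0 T, 0 ≤ g t) :
    ∫ t in (0 : ℝ)..T, f t ^ a * g t ^ b ≤
      (∫ t in (0 : ℝ)..T, f t) ^ a * (∫ t in (0 : ℝ)..T, g t) ^ b := by
  have ha1 : a < 1 := by linarith
  have hb1 : b < 1 := by linarith
  set μ : Measure ℝ := volume.restrict (Ioc 0 T) with hμ
  haveI : IsFiniteMeasure μ := by rw [hμ]; infer_instance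
  have hpq : (1 / a).HolderConjugate (1 / b) := by
    refine Real.holderConjugate_iff.2 ⟨by rw [lt_div_iff₀ ha]; linarith, ?_⟩
    rw [inv_div, inv_div, div_one, div_one, hab]
  have hmemLp : ∀ {φ : ℝ → ℝ}, ContinuousOn φ (Icc 0 T) → ∀ r : ℝ≥0∞, MemLp φ r μ := by
    intro φ hφ r
    obtain ⟨C, hC⟩ := isCompact_Icc.exists_bound_of_continuousOn hφ
    have hmeas : AEStronglyMeasurable φ μ :=
      (hφ.mono Ioc_subset_Icc_self).aestronglyMeasurable measurableSet_Ioc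
    refine MemLp.of_bound hmeas C ?_
    rw [hμ, ae_restrict_iff' measurableSet_Ioc]
    exact ae_of_all _ fun t ht => hC t (Ioc_subset_Icc_self ht)
  have hfac : ContinuousOn (fun t => f t ^ a) (Icc 0 T) := hfc.rpow_const fun t _ => Or.inr ha.le
  have hgbc : ContinuousOn (fun t => g t ^ b) (Icc 0 T) := hgc.rpow_const fun t _ => Or.inr hb.le
  have hfa0 : 0 ≤ᵐ[μ] fun t => f t ^ a := by
    rw [hμ, Filter.EventuallyLE, ae_restrict_iff' measurableSet_Ioc]
    exact ae_of_all _ fun t ht => Real.rpow_nonneg (hf0 t (Ioc_subset_Icc_self ht)) _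
  have hgb0 : 0 ≤ᵐ[μ] fun t => g t ^ b := by
    rw [hμ, Filter.EventuallyLE, ae_restrict_iff' measurableSet_Ioc]
    exact ae_of_all _ fun t ht => Real.rpow_nonneg (hg0 t (Ioc_subset_Icc_self ht)) _
  have hH := integral_mul_le_Lp_mul_Lq_of_nonneg (μ := μ) hpq hfa0 hgb0 (hmemLp hfac _) (hmemLp hgbc _)
  have hI1 : ∫ t, (f t ^ a) ^ (1 / a) ∂μ = ∫ t in (0 : ℝ)..T, f t := by
    rw [intervalIntegral.integral_of_le hT.le, hμ]
    refine integral_congr_ae ((ae_restrict_iff' measurableSet_Ioc).2 (ae_of_all _ fun t ht => ?_))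
    show (f t ^ a) ^ (1 / a) = f t
    rw [← Real.rpow_mul (hf0 t (Ioc_subset_Icc_self ht)), mul_one_div_cancel ha.ne', Real.rpow_one]
  have hI2 : ∫ t, (g t ^ b) ^ (1 / b) ∂μ = ∫ t in (0 : ℝ)..T, g t := by
    rw [intervalIntegral.integral_of_le hT.le, hμ]
    refine integral_congr_ae ((ae_restrict_iff' measurableSet_Ioc).2 (ae_of_all _ fun t ht => ?_))
    show (g t ^ b) ^ (1 / b) = g t
    rw [← Real.rpow_mul (hg0 t (Ioc_subset_Icc_self ht)), mul_one_div_cancel hb.ne', Real.rpow_one]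
  have hL : ∫ t in (0 : ℝ)..T, f t ^ a * g t ^ b = ∫ t, f t ^ a * g t ^ b ∂μ := by
    rw [intervalIntegral.integral_of_le hT.le, hμ]
  rw [hL]
  refine hH.trans_eq ?_
  rw [hI1, hI2, one_div_one_div, one_div_one_div]

/-- **The Hölder step of the FGT time averages** (`(2s+1, (2s+1)/(2s))` in time, `s ≥ 1`): along a
classical solution on `[0, T] × T³`, if `ν∫₀ᵀ E_{s+1}/(1+E_s)^{1+1/(2s−1)} ≤ W` and
`∫₀ᵀ E_s^{1/(2s−1)} ≤ A`, then
`∫₀ᵀ E_{s+1}^{1/(2s+1)} dt ≤ (W/ν)^{1/(2s+1)} (T + A)^{2s/(2s+1)}`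
(`E_{s+1}^{1/(2s+1)} = [E_{s+1}/(1+E_s)^{β}]^{1/(2s+1)} (1+E_s)^{β/(2s+1)}`, `β/(2s+1)·(2s+1)/(2s) = 1/(2s−1)`,
and `(1+E_s)^{1/(2s−1)} ≤ 1 + E_s^{1/(2s−1)}` since `1/(2s−1) ≤ 1`).
[cite: FoiasGuillopeTemam1981, Thm 3.1 (proof, the Hölder step)] (real order, classical solutions; ours) -/
theorem timeAverage_step {s ν T W A : ℝ} (hs : 1 ≤ s) (hν : 0 < ν) (hT : 0 < T)
    {u : ℝ → UnitAddTorus (Fin 3) → EuclideanSpace ℝ (Fin 3)} {p : ℝ → UnitAddTorus (Fin 3) → ℝ}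
    (h : IsClassicalNSSolutionOn (Icc 0 T) ν 0 u p)
    (hW : ν * ∫ t in (0 : ℝ)..T, torusHsEnergy (s + 1) (u t) /
        (1 + torusHsEnergy s (u t)) ^ (1 + (2 * s - 1)⁻¹) ≤ W)
    (hA : ∫ t in (0 : ℝ)..T, torusHsEnergy s (u t) ^ (2 * s - 1)⁻¹ ≤ A) :
    ∫ t in (0 : ℝ)..T, torusHsEnergy (s + 1) (u t) ^ (2 * s + 1)⁻¹ ≤
      (W / ν) ^ (2 * s + 1)⁻¹ * (T + A) ^ (2 * s / (2 * s + 1)) := by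
  have hs0 : 0 ≤ s := by linarith
  have h2s1 : 0 < 2 * s - 1 := by linarith
  have h2s1' : 0 < 2 * s + 1 := by linarith
  have hab' : (2 * s + 1)⁻¹ + 2 * s / (2 * s + 1) = 1 := by
    field_simp; ring
  have hβa' : (1 + (2 * s - 1)⁻¹) * (2 * s + 1)⁻¹ = (2 * s - 1)⁻¹ * (2 * s / (2 * s + 1)) := by
    field_simp; ring
  set σ : ℝ := 2 * s - 1 with hσ
  set β : ℝ := 1 + (2 * s - 1)⁻¹ with hβ
  set a : ℝ := (2 * s + 1)⁻¹ with ha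
  set b : ℝ := 2 * s / (2 * s + 1) with hb
  have ha0 : 0 < a := by rw [ha]; positivity
  have hb0 : 0 < b := by rw [hb]; positivity
  have hab : a + b = 1 := hab'
  have hβ0 : 0 < β := by rw [hβ]; positivity
  have hβa : β * a = σ⁻¹ * b := hβa'
  set F : ℝ → ℝ := fun t => torusHsEnergy s (u t) with hFdef
  set I : ℝ → ℝ := fun t => torusHsEnergy (s + 1) (u t) with hIdef
  have hF0 : ∀ t ∈ Icc 0 T, 0 ≤ F t := fun t ht =>
    torusHsEnergy_nonneg hs0 (h.smooth_velocity.isSmooth_slice ht)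
  have hI0 : ∀ t ∈ Icc 0 T, 0 ≤ I t := fun t ht =>
    torusHsEnergy_nonneg (by linarith) (h.smooth_velocity.isSmooth_slice ht)
  have h1F : ∀ t ∈ Icc 0 T, 0 < 1 + F t := fun t ht => by have := hF0 t ht; positivity
  -- the two factors
  set f : ℝ → ℝ := fun t => I t / (1 + F t) ^ β with hf
  set g : ℝ → ℝ := fun t => (1 + F t) ^ (σ⁻¹) with hg
  have hf0 : ∀ t ∈ Icc 0 T, 0 ≤ f t := fun t ht =>
    div_nonneg (hI0 t ht) (Real.rpow_nonneg (h1F t ht).le _)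
  have hg0 : ∀ t ∈ Icc 0 T, 0 ≤ g t := fun t ht => Real.rpow_nonneg (h1F t ht).le _
  -- pointwise `I^a = f^a g^b` on `[0, T]`
  have hpt : ∀ t ∈ Icc 0 T, I t ^ a = f t ^ a * g t ^ b := by
    intro t ht
    have hQ : 0 < (1 + F t) ^ β := Real.rpow_pos_of_pos (h1F t ht) _
    have e : I t = f t * (1 + F t) ^ β := by
      rw [hf]; simp only; rw [div_mul_cancel₀ _ hQ.ne']
    rw [e, Real.mul_rpow (hf0 t ht) hQ.le, ← Real.rpow_mul (h1F t ht).le, hβa, hg]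
    simp only
    rw [← Real.rpow_mul (h1F t ht).le]
  -- continuity
  have hFc : ContinuousOn F (Icc 0 T) := continuousOn_hsEnergy hs0 hT h
  have hIc : ContinuousOn I (Icc 0 T) := continuousOn_hsEnergy (by linarith) hT h
  have h1Fc : ContinuousOn (fun t => 1 + F t) (Icc 0 T) := continuousOn_const.add hFc
  have hfc : ContinuousOn f (Icc 0 T) :=
    hIc.div (h1Fc.rpow_const fun t ht => Or.inl (h1F t ht).ne')
      fun t ht => (Real.rpow_pos_of_pos (h1F t ht) _).ne'
  have hgc : ContinuousOn g (Icc 0 T) := h1Fc.rpow_const fun t ht => Or.inl (h1F t ht).ne'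
  -- Hölder
  have hH := integral_rpow_mul_rpow_le hT ha0 hb0 hab hfc hgc hf0 hg0
  have hL : ∫ t in (0 : ℝ)..T, I t ^ a = ∫ t in (0 : ℝ)..T, f t ^ a * g t ^ b :=
    intervalIntegral.integral_congr fun t ht => hpt t (by rwa [uIcc_of_le hT.le] at ht)
  -- the two inputs
  have hfi : ∫ t in (0 : ℝ)..T, f t ≤ W / ν := by
    rw [le_div_iff₀ hν, mul_comm]; exact hW
  have hgi : ∫ t in (0 : ℝ)..T, g t ≤ T + A := by
    have hσ1 : σ⁻¹ ≤ 1 := inv_le_one_of_one_le₀ (by rw [hσ]; linarith)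
    have h13 : ∀ t ∈ Icc 0 T, g t ≤ 1 + F t ^ (σ⁻¹) := fun t ht => by
      have := Real.rpow_add_le_add_rpow zero_le_one (hF0 t ht) (inv_nonneg.2 h2s1.le) hσ1
      simpa [hg] using this
    have hFσc : ContinuousOn (fun t => F t ^ (σ⁻¹)) (Icc 0 T) :=
      hFc.rpow_const fun t _ => Or.inr (inv_nonneg.2 h2s1.le)
    have hFσi : IntervalIntegrable (fun t => F t ^ (σ⁻¹)) volume 0 T :=
      (hFσc.mono (by rw [uIcc_of_le hT.le])).intervalIntegrable
    have hgi' : IntervalIntegrable g volume 0 T := (hgc.mono (by rw [uIcc_of_le hT.le])).intervalIntegrable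
    have hmono : ∫ t in (0 : ℝ)..T, g t ≤ ∫ t in (0 : ℝ)..T, (1 + F t ^ (σ⁻¹)) :=
      intervalIntegral.integral_mono_on hT.le hgi' (intervalIntegrable_const.add hFσi)
        fun t ht => h13 t ht
    rw [intervalIntegral.integral_add intervalIntegrable_const hFσi, intervalIntegral.integral_const,
      smul_eq_mul, sub_zero, mul_one] at hmono
    have hA' : ∫ t in (0 : ℝ)..T, F t ^ (σ⁻¹) ≤ A := by rw [hσ]; exact hA
    linarith
  have hfi0 : 0 ≤ ∫ t in (0 : ℝ)..T, f t := intervalIntegral.integral_nonneg hT.le fun t ht => hf0 t ht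
  have hgi0 : 0 ≤ ∫ t in (0 : ℝ)..T, g t := intervalIntegral.integral_nonneg hT.le fun t ht => hg0 t ht
  rw [hL]
  refine hH.trans ?_
  exact mul_le_mul (Real.rpow_le_rpow hfi0 hfi ha0.le) (Real.rpow_le_rpow hgi0 hgi hb0.le)
    (Real.rpow_nonneg hgi0 _) (Real.rpow_nonneg (hfi0.trans hfi) _)

end HsTimeAverages

end Summit.NavierStokesRegularity.FunctionalMining
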